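import Literature.NumberTheory.LFunctions.ExplicitLandauPageFamily
import HarnessLib

/-!
# The explicit Deuring–Heilbronn phenomenon for the FAMILY of all primitive Dirichlet `L`-functions
# to moduli `q ≤ Q` (Thorner–Zaman 2024, §2.4, Theorem 2.15), with the printed decimals of the
# §2.2 constants proved

Topic `Literature/NumberTheory/LFunctions` (namespace `Literature.NumberTheory.LFunctions`; the
paper's objects in the sub-namespace `ThornerZaman2024`, shared with
`ExplicitLogFreeZeroDensityDirichlet.lean` (Theorem 1.2 / Corollary 6.1; `ThornerZaman2024.betaOne Q
= β₁(Q)`) and `ExplicitLandauPageFamily.lean` (§2.2: Lemma 2.4, Corollary 2.5, Theorem 2.6; the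
constants `zfrConst = 1/9.645908801`, `landauConst = (15 − 10√2)/(5 − √5)`,
`pageConst = landauConst/2`), both reused verbatim — nothing there is restated). STATEMENT LAYER
(D-0014 / D-0064), typed for the cell `landau-siegel`, family B-dh (explicit Deuring–Heilbronn /
log-free zero-density chains as a substitute endgame; HARVEST row T-030 = r3-T04): the chains'
constants table needs an explicit repulsion valid for ALL moduli `q ≤ Q` at once, whereas the
tree's `BGTZ2025.corollary11` (Benli–Goel–Twiss–Zaman 2025, `c₁ = 10, c₂ = 1, c₃ = 107,
c₄ = 1/16`) is stated one modulus at a time.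

Source: J. Thorner, A. Zaman, *An explicit version of Bombieri's log-free density estimate and
Sárközy's theorem for shifted primes*, Forum Math. 36 (2024) 1059–1080 [ThornerZaman2024LogFree],
read from the held copy arXiv:2208.11123 (§2.4, p. 8 of that copy; §2.2, p. 5 for the decimals).

## What the source prints (verbatim)

With `𝓛(s,Q) := ∏_{1 ≤ q ≤ Q} ∏_{χ (mod q) primitive} L(s,χ)`,
`β₁(Q) := max{β ∈ ℝ : 𝓛(β,Q) = 0}` ((1.1), p. 3) and `c₁ = 1/9.645908801` (Lemma 2.3):

* §2.4 "The Deuring–Heilbronn phenomenon. Here, we quantify the idea that if `β₁(Q)` is close to `1`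
  in Theorem 2.6, then the zero-free region for all other Dirichlet `L`-functions (including `ζ(s)`)
  improves as a specific function of how close `β₁(Q)` is to `s = 1`. … We use Corollary 2.14
  [the power-sum inequality of Kadiri–Ng–Wong, Lemma 2.13] to prove what appears to be the first
  completely explicit version of the Deuring–Heilbronn zero repulsion phenomenon."
* **Theorem 2.15** (p. 8). "Let `Q > 400 000` and `T ≥ 1`. Recall (1.1) and Theorem 2.6. Suppose
  that `β₁(Q) ≥ 1 − c₁/log Q`, and let `χ₁ (mod q₁)` be the corresponding primitive quadratic
  character with `q₁ ∈ (400 000, Q]`. If `β + iγ ≠ β₁(Q)` is a nontrivial zero of `𝓛(s,Q)` with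
  `β > 1/2` and `|γ| ≤ T`, then
  `β ≤ 1 − log(1/((1 − β₁(Q))(670 564.676 + 347 029.502 log Q + 107 906.278 log T)))/(104.645 + 54.156 log Q + 16.84 log T)`."
  Remarks ibid.: "Our proof produces a stronger result than we have stated. For numerical
  convenience, we assign specific values to the parameters `ε` and `α` occurring in our proof";
  "Jutila proved a numerically stronger result under the assumption that `QT` is sufficiently large
  … To our knowledge, Theorem 2.15 is the only explicit result of its type with no such hypotheses."
  First line of the proof: "The result is trivial when
  `β₁(Q) ≤ 1 − 1/(670 564.676 + 347 029.502 log Q + 107 906.278 log T)`."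
* §2.2 decimals (p. 5): `(15 − 10√2)/((5 − √5)) = 0.3103782…` (Lemma 2.4) and
  `(15 − 10√2)/(2(5 − √5)) = 0.1551891…` (Corollary 2.5).
* How the source itself uses Theorem 2.15 (§5.3, p. 16, with `T = Q`): for
  `σ > 1 − log(1/((1 − β₁(Q))(670 564.676 + 454 935.78 log Q)))/(104.645 + 70.996 log Q)` one has
  `N*(σ,Q) = 0` — the repulsion half of the explicit Bombieri estimate `thornerZaman2024_theorem12`.

## Lean rendering / design choices

* Exactly the shape of `thornerZaman2024_theorem26a` (companion file): a character "mod `q ≤ Q`" is a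
  `DirichletCharacter ℂ q`, `[NeZero q]`, `(q : ℝ) ≤ Q`; "zero `β + iγ ≠ β₁(Q)` of `𝓛(s,Q)`" =
  `L(ρ,χ) = 0` for some primitive `χ` mod `q ≤ Q`, `ρ ≠ β₁(Q)`, with the guard `ρ ≠ 1` (the
  modulus-`1` factor is `ζ`, which has a pole at `1` where Mathlib assigns a finite junk value; a
  genuine zero with `β > 1/2` is never `1`). "Nontrivial" is implied by `β > 1/2`.
* The hypothesis "let `χ₁ (mod q₁)` be the corresponding primitive quadratic character" names an
  object (supplied by Theorem 2.6 / Corollary 2.5) that does not occur in the conclusion; it is not a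
  hypothesis of the Lean statement.
* The bound has its OWN shape — two different affine forms of `(log Q, log T)`, one inside the
  logarithm (`dhInner`) and one as the denominator (`dhDenom`) — so it is NOT an instance of the
  tree's single-modulus shape `BGTZ2025.repulsionBound c₁ c₂ c₃ c₄ q T β₁` (where the same form
  `c₁ log q + c₂ log T + c₃` occurs in both places); Benli–Goel–Twiss–Zaman only report that Theorem
  2.15 "implies `c₁ = 54.2, c₂ = 16.9, c₃ = 104.7, c₄ = 0.0002` are admissible" for one modulus,
  a weakening we do not restate. Rendered verbatim as `ThornerZaman2024.dhBound Q T β₁`.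
* `β₁(Q)` = `ThornerZaman2024.betaOne Q`; the hypothesis "`β₁(Q) ≥ 1 − c₁/log Q`" is stated on that
  real number exactly as in `thornerZaman2024_theorem26b`.

## Contents

* `ThornerZaman2024.dhInner`, `.dhDenom`, `.dhBound` (definitions with bodies) and PROVED API:
  `dhInner_pos`, `dhDenom_pos`, `one_le_dhBound_of_le` (the paper's "trivial range" remark: if
  `(1 − β₁)·dhInner ≥ 1` the bound is `≥ 1` and says nothing), `dhBound_lt_one_of_lt` (in the
  complementary range the bound is a genuine zero-free region `< 1`).
* `thornerZaman2024_theorem215` — **Theorem 2.15** (NAMED FACT, as printed; not proved here).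
* PROVED decimals of the companion file's closed-form constants: `ThornerZaman2024.landauConst_bounds`
  (`0.3103782 < (15 − 10√2)/(5 − √5) < 0.3103783`), `ThornerZaman2024.pageConst_bounds`
  (`0.1551891 < … < 0.1551892`), `ThornerZaman2024.zfrConst_bounds` (`0.10367 < 1/9.645908801 < 0.10368`).
* PROVED comparison `ThornerZaman2024.family_threshold_ge`: the family threshold
  `1 − c₁/log max{Q, Q|t|}` of Theorem 2.6 dominates the single-modulus threshold
  `1 − c₁/log max{q, q|t|}` (McCurley / Lemma 2.3) for `3 ≤ q ≤ Q` — uniformity in `q ≤ Q` costs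
  exactly the replacement of `q` by `Q` inside the logarithm.

WHAT THIS IS NOT: a discharge of Theorem 2.15 (power sums over zeros with explicit zero counts,
§2.3–§2.4 of the source, size L); no claim about Landau–Siegel zeros — the named fact is an explicit
hypothesis its users carry; nothing here bears on parity. No instance, no notation.
-/

noncomputable section

open scoped Classical

namespace Literature.NumberTheory.LFunctions

namespace ThornerZaman2024

/-! ### Printed decimals of the §2.2 constants (proved) -/

/-- Decimal enclosure of `√2` (helper for `landauConst_bounds`). [folklore] -/
private theorem sqrt_two_bounds : (1.41421356 : ℝ) < Real.sqrt 2 ∧ Real.sqrt 2 < 1.414213563 := by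
  constructor
  · rw [Real.lt_sqrt (by norm_num)]; norm_num
  · rw [Real.sqrt_lt' (by norm_num)]; norm_num

/-- Decimal enclosure of `√5` (helper for `landauConst_bounds`). [folklore] -/
private theorem sqrt_five_bounds : (2.2360679 : ℝ) < Real.sqrt 5 ∧ Real.sqrt 5 < 2.236068 := by
  constructor
  · rw [Real.lt_sqrt (by norm_num)]; norm_num
  · rw [Real.sqrt_lt' (by norm_num)]; norm_num

/-- **The printed decimals of Lemma 2.4**: `0.3103782 < (15 − 10√2)/(5 − √5) < 0.3103783`
("`= 1 − 0.310 378 2…/log(q′q/17)`"). [cite: ThornerZaman2024LogFree, Lemma 2.4] -/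
theorem landauConst_bounds : 0.3103782 < landauConst ∧ landauConst < 0.3103783 := by
  obtain ⟨h2l, h2u⟩ := sqrt_two_bounds
  obtain ⟨h5l, h5u⟩ := sqrt_five_bounds
  have hden : (0 : ℝ) < 5 - Real.sqrt 5 := by linarith
  unfold landauConst
  constructor
  · rw [lt_div_iff₀ hden]; nlinarith
  · rw [div_lt_iff₀ hden]; nlinarith

/-- **The printed decimals of Corollary 2.5**: `0.1551891 < (15 − 10√2)/(2(5 − √5)) < 0.1551892`
("`= 1 − 0.155 189 1…/log Q`"). [cite: ThornerZaman2024LogFree, Corollary 2.5] -/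
theorem pageConst_bounds : 0.1551891 < pageConst ∧ pageConst < 0.1551892 := by
  obtain ⟨hl, hu⟩ := landauConst_bounds
  rw [pageConst_eq_half_landauConst]
  constructor <;> linarith

/-- **The constant of Lemma 2.3 / Theorem 2.6 in decimals**: `0.10367 < 1/9.645908801 < 0.10368`
(cf. the `0.10367/log(q(2+|t|))` form quoted in the explicit-zeros literature).
[cite: ThornerZaman2024LogFree, Lemma 2.3] -/
theorem zfrConst_bounds : 0.10367 < zfrConst ∧ zfrConst < 0.10368 := by
  unfold zfrConst
  constructor <;> norm_num

/-- **Theorem 2.6's region is modulus-by-modulus SMALLER than Lemma 2.3's (McCurley's)**: for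
`3 ≤ q ≤ Q` and any height `t`, `1 − c₁/log max{q, q|t|} ≤ 1 − c₁/log max{Q, Q|t|}` — uniformity
over the family `q ≤ Q` costs exactly the replacement of `q` by `Q` inside the logarithm.
[cite: ThornerZaman2024LogFree, Theorem 2.6] -/
theorem family_threshold_ge {q : ℕ} (hq : 3 ≤ q) {Q : ℝ} (hqQ : (q : ℝ) ≤ Q) (t : ℝ) :
    1 - zfrConst / Real.log (max (q : ℝ) ((q : ℝ) * |t|)) ≤
      1 - zfrConst / Real.log (max Q (Q * |t|)) := by
  have hq3 : (3 : ℝ) ≤ (q : ℝ) := by exact_mod_cast hq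
  have hmq : (3 : ℝ) ≤ max (q : ℝ) ((q : ℝ) * |t|) := hq3.trans (le_max_left _ _)
  have hmono : max (q : ℝ) ((q : ℝ) * |t|) ≤ max Q (Q * |t|) :=
    max_le_max hqQ (mul_le_mul_of_nonneg_right hqQ (abs_nonneg t))
  have hlog3 : 1 < Real.log 3 := by
    rw [Real.lt_log_iff_exp_lt (by norm_num)]
    linarith [Real.exp_one_lt_d9]
  have hlq : 1 < Real.log (max (q : ℝ) ((q : ℝ) * |t|)) :=
    hlog3.trans_le (Real.log_le_log (by norm_num) hmq)
  have hlQ : Real.log (max (q : ℝ) ((q : ℝ) * |t|)) ≤ Real.log (max Q (Q * |t|)) :=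
    Real.log_le_log (by linarith) hmono
  have hc : (0 : ℝ) ≤ zfrConst := by linarith [zfrConst_bounds.1]
  have := div_le_div_of_nonneg_left hc (by linarith : (0:ℝ) < _) hlQ
  linarith

/-! ### The objects of Theorem 2.15 -/

/-- The quantity inside the logarithm of Theorem 2.15 (to be multiplied by `1 − β₁(Q)`):
`670 564.676 + 347 029.502 log Q + 107 906.278 log T`. [cite: ThornerZaman2024LogFree, Theorem 2.15] -/
def dhInner (Q T : ℝ) : ℝ :=
  670564.676 + 347029.502 * Real.log Q + 107906.278 * Real.log T

/-- The denominator of Theorem 2.15: `104.645 + 54.156 log Q + 16.84 log T`.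
[cite: ThornerZaman2024LogFree, Theorem 2.15] -/
def dhDenom (Q T : ℝ) : ℝ :=
  104.645 + 54.156 * Real.log Q + 16.84 * Real.log T

/-- The right-hand side of Theorem 2.15 as a function of `(Q, T, β₁)`:
`1 − log(1/((1 − β₁)(670 564.676 + 347 029.502 log Q + 107 906.278 log T)))/(104.645 + 54.156 log Q + 16.84 log T)`.
[cite: ThornerZaman2024LogFree, Theorem 2.15] -/
def dhBound (Q T β₁ : ℝ) : ℝ :=
  1 - Real.log (1 / ((1 - β₁) * dhInner Q T)) / dhDenom Q T

/-- For `Q ≥ 1`, `T ≥ 1` the inner quantity is positive (indeed `≥ 670 564.676`).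
[cite: ThornerZaman2024LogFree, Theorem 2.15] -/
theorem dhInner_pos {Q T : ℝ} (hQ : 1 ≤ Q) (hT : 1 ≤ T) : 0 < dhInner Q T := by
  unfold dhInner
  have h1 : 0 ≤ Real.log Q := Real.log_nonneg hQ
  have h2 : 0 ≤ Real.log T := Real.log_nonneg hT
  positivity

/-- For `Q ≥ 1`, `T ≥ 1` the denominator is positive (indeed `≥ 104.645`).
[cite: ThornerZaman2024LogFree, Theorem 2.15] -/
theorem dhDenom_pos {Q T : ℝ} (hQ : 1 ≤ Q) (hT : 1 ≤ T) : 0 < dhDenom Q T := by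
  unfold dhDenom
  have h1 : 0 ≤ Real.log Q := Real.log_nonneg hQ
  have h2 : 0 ≤ Real.log T := Real.log_nonneg hT
  positivity

/-- **The "trivial range" of Theorem 2.15** (first display of its proof, p. 8): if
`β₁ ≤ 1 − 1/(670 564.676 + 347 029.502 log Q + 107 906.278 log T)`, i.e. `(1 − β₁)·dhInner ≥ 1`,
then the logarithm is `≤ 0` and `dhBound Q T β₁ ≥ 1` — no zero with `β < 1` is excluded. The
content of the theorem is the complementary range `(1 − β₁(Q))·dhInner < 1`.
[cite: ThornerZaman2024LogFree, Theorem 2.15 (proof, first display)] -/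
theorem one_le_dhBound_of_le {Q T β₁ : ℝ} (hQ : 1 ≤ Q) (hT : 1 ≤ T)
    (h : β₁ ≤ 1 - 1 / dhInner Q T) : 1 ≤ dhBound Q T β₁ := by
  have hI := dhInner_pos hQ hT
  have hD := dhDenom_pos hQ hT
  have hprod : 1 ≤ (1 - β₁) * dhInner Q T := by
    have : 1 / dhInner Q T ≤ 1 - β₁ := by linarith
    calc (1 : ℝ) = 1 / dhInner Q T * dhInner Q T := by field_simp
      _ ≤ (1 - β₁) * dhInner Q T := by gcongr
  have hlog : Real.log (1 / ((1 - β₁) * dhInner Q T)) ≤ 0 := by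
    apply Real.log_nonpos (by positivity)
    rw [div_le_one (by linarith)]
    exact hprod
  unfold dhBound
  have : Real.log (1 / ((1 - β₁) * dhInner Q T)) / dhDenom Q T ≤ 0 :=
    div_nonpos_of_nonpos_of_nonneg hlog hD.le
  linarith

/-- **The content range of Theorem 2.15**: if `1 − 1/dhInner < β₁ < 1`, i.e.
`0 < (1 − β₁)·dhInner < 1`, then the logarithm is `> 0` and `dhBound Q T β₁ < 1` is a genuine
zero-free region below `Re s = 1`, widening as `β₁ → 1⁻`.
[cite: ThornerZaman2024LogFree, Theorem 2.15 (proof, first display)] -/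
theorem dhBound_lt_one_of_lt {Q T β₁ : ℝ} (hQ : 1 ≤ Q) (hT : 1 ≤ T)
    (h : 1 - 1 / dhInner Q T < β₁) (hβ : β₁ < 1) : dhBound Q T β₁ < 1 := by
  have hI := dhInner_pos hQ hT
  have hD := dhDenom_pos hQ hT
  have hpos : 0 < (1 - β₁) * dhInner Q T := mul_pos (by linarith) hI
  have hprod : (1 - β₁) * dhInner Q T < 1 := by
    have : 1 - β₁ < 1 / dhInner Q T := by linarith
    calc (1 - β₁) * dhInner Q T < 1 / dhInner Q T * dhInner Q T := by gcongr
      _ = 1 := by field_simp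
  have hlog : 0 < Real.log (1 / ((1 - β₁) * dhInner Q T)) := by
    apply Real.log_pos
    rw [lt_div_iff₀ hpos]
    linarith
  unfold dhBound
  have : 0 < Real.log (1 / ((1 - β₁) * dhInner Q T)) / dhDenom Q T := div_pos hlog hD
  linarith

end ThornerZaman2024

open ThornerZaman2024

/-! ### The named fact -/

/-- **Thorner–Zaman 2024, Theorem 2.15 (NAMED FACT, as printed): the first completely explicit
Deuring–Heilbronn repulsion, for the whole family `q ≤ Q` at once.** "Let `Q > 400 000` and
`T ≥ 1`. Recall (1.1) and Theorem 2.6. Suppose that `β₁(Q) ≥ 1 − c₁/log Q`, and let `χ₁ (mod q₁)`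
be the corresponding primitive quadratic character with `q₁ ∈ (400 000, Q]`. If
`β + iγ ≠ β₁(Q)` is a nontrivial zero of `𝓛(s,Q)` with `β > 1/2` and `|γ| ≤ T`, then
`β ≤ 1 − log(1/((1 − β₁(Q))(670 564.676 + 347 029.502 log Q + 107 906.278 log T)))/(104.645 + 54.156 log Q + 16.84 log T)`."
Rendering: for every primitive `χ` mod `q ≤ Q` and every zero `ρ ≠ β₁(Q)` of `L(s,χ)` (`ρ ≠ 1`:
pole of the modulus-`1` factor `ζ`) with `Re ρ > 1/2` and `|Im ρ| ≤ T`: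
`Re ρ ≤ dhBound Q T (β₁(Q))`, `β₁(Q) = ThornerZaman2024.betaOne Q`, `c₁ = ThornerZaman2024.zfrConst`.
Trivial when `(1 − β₁(Q))·dhInner Q T ≥ 1` (`one_le_dhBound_of_le`). For a SINGLE modulus the
tree's `BGTZ2025.corollary11` (`c₁ = 10`, `c₂ = 1`, `c₃ = 107`, `c₄ = 1/16`) supersedes it; this is
the only explicit repulsion in print stated for all `q ≤ Q` simultaneously. Not proved here (power
sums over zeros: Lemma 2.13 = Kadiri–Ng–Wong Thm 2.2, Corollary 2.12).
[cite: ThornerZaman2024LogFree, Theorem 2.15] -/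
def thornerZaman2024_theorem215 : Prop :=
  ∀ Q T : ℝ, 400000 < Q → 1 ≤ T → 1 - zfrConst / Real.log Q ≤ betaOne Q →
    ∀ (q : ℕ) [NeZero q] (χ : DirichletCharacter ℂ q), (q : ℝ) ≤ Q → χ.IsPrimitive →
      ∀ ρ : ℂ, ρ ≠ 1 → ρ ≠ ((betaOne Q : ℝ) : ℂ) → χ.LFunction ρ = 0 →
        1 / 2 < ρ.re → |ρ.im| ≤ T → ρ.re ≤ dhBound Q T (betaOne Q)

/-- **The `T = Q` specialisation used in the source's §5.3** (p. 16: "by Theorem 2.15 with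
`T = Q > 400 000`, we must have that `N*(σ,Q) = 0`" above the threshold): with `T = Q` the inner
quantity is `670 564.676 + 454 935.78 log Q` and the denominator `104.645 + 70.996 log Q`, as
printed there (`347 029.502 + 107 906.278 = 454 935.78`, `54.156 + 16.84 = 70.996`).
[cite: ThornerZaman2024LogFree, §5.3 (first display)] -/
theorem ThornerZaman2024.dhBound_self (Q β₁ : ℝ) :
    dhBound Q Q β₁ =
      1 - Real.log (1 / ((1 - β₁) * (670564.676 + 454935.78 * Real.log Q))) /
        (104.645 + 70.996 * Real.log Q) := by
  unfold dhBound dhInner dhDenom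
  ring_nf

end Literature.NumberTheory.LFunctions

end
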